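import Summits.HubbardSuperconductivity.HubbardSuperconductivity.Theorems.AnisotropyChordTransferLift

/-!
# Route `AnisotropyChord` / H0 rotor rung — PART N21(b): near-END IN EVERY SECTOR FROM CLR + THE UNIFORM TRIAL

Verbatim port, part (b), of the theory seat `hubbard-h0-rotor-theory-1` cycle-19 file `cycle19/lean/PartN21.lean`
(sha16 f6731c0994a9c97e, memo ROTOR-THEORY-19 §230/§234; part (a) = `AnisotropyChordTransferLift.lean`).  PROVED here:

* `nearEnd_of_ferroSectorGapCLR` : with the Caputo–Liggett–Richthammer value `g = 1 − cos(2π/L)` (the tree's named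
  hypothesis `FerroSectorGapCLR`) every sector gap of `H(Δ)`, `Δ ≤ 1`, is at least `1 − cos(2π/L) − t₀(Δ, M)`;
* `sectorE_one_ge` : `E_1(M) ≥ −D/8`;
* `groundLift_le_tangent` : the uniform-trial bound `t₀(Δ, M) ≤ (1 − Δ)·2n(n−1)/(|V| − 1)` (Rayleigh–Ritz with the uniform
  sector state, the exchangeability count `V(V−1)A = n(V−n)|S|`, `E_1(M) ≥ −D/8`, `D ≤ 4|V|`);
* `nearEnd_uniform` (THEOREM near-END, uniform-trial version, ALL sectors, kernel-checked modulo CLR):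
  `γ_n(Δ,L) ≥ (1 − cos 2π/L) − (1 − Δ)·2n(n−1)/(|V| − 1)`, `n = |V|/2 + M`.

The memo's THEOREM near-END₃ / PROP D / near-END-dilute are upper bounds on `t₀` (trial states) and are NOT typed here.
-/

set_option linter.dupNamespace false


open Finset
open Literature.MathematicalPhysics.QuantumLattice Literature.Probability.LatticeModels
open Summit.HubbardSuperconductivity.HubbardSuperconductivity.Theorems.AnisotropyChord.InsertionEntropy
open Summit.HubbardSuperconductivity.HubbardSuperconductivity.Theorems.AnisotropyChord.Tower
open Summit.HubbardSuperconductivity.HubbardSuperconductivity.Theorems.AnisotropyChord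

namespace Summit.HubbardSuperconductivity.HubbardSuperconductivity.Theorems.AnisotropyChord.Transfer

variable {L : ℕ} [NeZero L]

/-- **near-END from CLR (memo ROTOR-THEORY-19 §230, LEMMA 19.1 with the Caputo–Liggett–Richthammer value):**
under the tree's named hypothesis `FerroSectorGapCLR`, for every `L ≥ 3`, `Δ ≤ 1`, sector `M` and bound `t₀(Δ, M) ≤ t`,
the full sector gap of `H(Δ)` is at least `1 − cos(2π/L) − t`. [new: cycle 19] -/
theorem nearEnd_of_ferroSectorGapCLR (hCLR : FerroSectorGapCLR) {L : ℕ} [NeZero L] (hL : 3 ≤ L)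
    {Δ M t : ℝ} (hΔ : Δ ≤ 1) (ht : groundLift L Δ M ≤ t) :
    SectorGapAtLeast L Δ M (1 - Real.cos (2 * Real.pi / (L : ℝ)) - t) :=
  sectorGapAtLeast_of_lift hΔ (hCLR L hL M) ht

/-- the ferromagnetic sector energy is at least `−D/8` (`A ≥ 0`, `inner_fmOp_nonneg`). [folklore] -/
theorem sectorE_one_ge {M : ℝ} {a₁ : TensorIndex (TorusSite 2 L) 2 → ℝ} (ha₁ : IsPerronSectorGroundAmplitude L 1 M a₁) :
    -((1/8 : ℝ) * ∑ x : TorusSite 2 L, ∑ y, if (torusGraph 2 L).Adj x y then (1:ℝ) else 0) ≤ sectorE L 1 M := by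
  have h := perron_energyQ ha₁
  rw [energyQ_eq_real, ha₁.unit] at h
  have h0 := inner_fmOp_nonneg (torusGraph 2 L) a₁
  have hsplit : (∑ σ, a₁ σ * (fmOp (torusGraph 2 L) a₁ σ + (1 - (1:ℝ)) * (isingW (torusGraph 2 L) σ * a₁ σ)))
      = ∑ σ, a₁ σ * fmOp (torusGraph 2 L) a₁ σ := Finset.sum_congr rfl fun σ _ => by ring
  rw [hsplit] at h
  linarith

set_option maxHeartbeats 800000 in
/-- **THE UNIFORM-TRIAL (TANGENT) BOUND ON THE GROUND LIFT** (memo ROTOR-THEORY-19 §230 Remark (2)): for `L ≥ 2`, `Δ ≤ 1` and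
a genuine sector (`n = |V|/2 + M` particles), `t₀(Δ, M) ≤ (1 − Δ)·2n(n − 1)/(|V| − 1)` — Rayleigh–Ritz with the uniform sector state
(`sectorE_le_uniform` + the exchangeability count `V(V−1)A = n(V−n)|S|`), `E_1(M) ≥ −D/8`, and `D ≤ 4|V|`. [folklore] -/
theorem groundLift_le_tangent {Δ M : ℝ} {a : TensorIndex (TorusSite 2 L) 2 → ℝ}
    (ha : IsPerronSectorGroundAmplitude L Δ M a) (hL : 2 ≤ L) (hΔ : Δ ≤ 1) :
    groundLift L Δ M
      ≤ (1 - Δ) * (2 * ((Fintype.card (TorusSite 2 L) : ℝ) / 2 + M) * (((Fintype.card (TorusSite 2 L) : ℝ) / 2 + M) - 1))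
          / ((Fintype.card (TorusSite 2 L) : ℝ) - 1) := by
  obtain ⟨n, hnV, hn⟩ := perron_natSector ha
  set V : ℕ := Fintype.card (TorusSite 2 L) with hVdef
  have hVL : (V : ℝ) = (L : ℝ) ^ 2 := by
    have hcardT : Fintype.card (TorusSite 2 L) = L ^ 2 := by rw [Fintype.card_fun, ZMod.card, Fintype.card_fin]
    rw [hVdef, hcardT]; push_cast; ring
  have hV4 : (4 : ℝ) ≤ V := by
    rw [hVL]; have : (2 : ℝ) ≤ L := by exact_mod_cast hL
    nlinarith
  have hVpos : (0 : ℝ) < V := by linarith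
  have hV1 : (0 : ℝ) < (V : ℝ) - 1 := by linarith
  -- the occupation number of the sector
  set m : ℕ := V - n with hmdef
  have hmV : (m : ℝ) = (V : ℝ) - n := by rw [hmdef]; push_cast [Nat.cast_sub hnV]; ring
  have hm : ((V : ℝ) - (m : ℝ)) = (V : ℝ) / 2 + M := by rw [hmV, ← hn]; ring
  -- abbreviations
  obtain ⟨D, hD⟩ : ∃ D : ℝ, D = ∑ x : TorusSite 2 L, ∑ y, if (torusGraph 2 L).Adj x y then (1:ℝ) else 0 := ⟨_, rfl⟩
  set P : ℝ := ((Stiffness.Exch.sector (TorusSite 2 L) m).card : ℝ) with hP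
  -- the exchangeability constant A₀ on adjacent pairs
  set A₀ : ℝ := (Stiffness.Exch.A m (0 : TorusSite 2 L) ((0 : TorusSite 2 L) + Pi.single 0 1) : ℝ) with hA₀
  have hne0 : (0 : TorusSite 2 L) ≠ 0 + Pi.single 0 1 := (Stiffness.add_single_ne_self hL 0 0).symm
  have hAconst : ∀ x y : TorusSite 2 L, (torusGraph 2 L).Adj x y → (Stiffness.Exch.A m x y : ℝ) = A₀ := by
    intro x y hxy
    rw [hA₀]; exact_mod_cast Stiffness.Exch.A_const m hxy.ne hne0
  have hAcount : (V : ℝ) * ((V : ℝ) - 1) * A₀ = (n : ℝ) * ((V : ℝ) - n) * P := by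
    have h := Stiffness.Exch.card_card_pred_mul_A (α := TorusSite 2 L) m hne0
    have h' : ((Fintype.card (TorusSite 2 L) : ℕ) : ℝ) * (((Fintype.card (TorusSite 2 L) - 1 : ℕ)) : ℝ) * A₀
        = (m : ℝ) * (((Fintype.card (TorusSite 2 L) - m : ℕ)) : ℝ) * P := by
      rw [hA₀, hP]; exact_mod_cast h
    have h1V : 1 ≤ V := le_trans (by norm_num) (by exact_mod_cast (le_trans hV4 le_rfl : (4:ℝ) ≤ V) : 4 ≤ V)
    rw [← hVdef, Nat.cast_sub h1V, Nat.cast_sub (Nat.sub_le V n)] at h'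
    rw [hmV] at h'
    push_cast at h'
    linear_combination h'
  have hSA : (∑ x : TorusSite 2 L, ∑ y, if (torusGraph 2 L).Adj x y then (2 * (Stiffness.Exch.A m x y : ℝ)) else 0)
      = 2 * A₀ * D := by
    rw [hD, Finset.mul_sum]
    refine Finset.sum_congr rfl fun x _ => ?_
    rw [Finset.mul_sum]
    refine Finset.sum_congr rfl fun y _ => ?_
    by_cases hxy : (torusGraph 2 L).Adj x y
    · rw [if_pos hxy, if_pos hxy, hAconst x y hxy]; ring
    · rw [if_neg hxy, if_neg hxy]; ring
  -- P > 0: the sector of `a` is non-empty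
  have hPpos : 0 < P := by
    obtain ⟨σ₀, hσ₀⟩ : ∃ σ₀, a σ₀ ≠ 0 := by
      by_contra hall; push Not at hall
      have : ∑ σ, a σ ^ 2 = 0 := Finset.sum_eq_zero fun σ _ => by rw [hall σ]; ring
      rw [ha.unit] at this; exact one_ne_zero this
    have hz := perron_support ha σ₀ hσ₀
    rw [zerosCard_eq_card_sub_occ, ← hVdef] at hz
    have hocc : Stiffness.Exch.occ σ₀ = m := by
      have h1 : (Stiffness.Exch.occ σ₀ : ℝ) = (m : ℝ) := by rw [hmV]; linarith [hm]
      exact_mod_cast h1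
    have hmem : σ₀ ∈ Stiffness.Exch.sector (TorusSite 2 L) m := by
      unfold Stiffness.Exch.sector; rw [Finset.mem_filter]; exact ⟨Finset.mem_univ _, hocc⟩
    rw [hP]; exact_mod_cast Finset.card_pos.2 ⟨σ₀, hmem⟩
  -- (U) Rayleigh–Ritz with the uniform state:  (E_Δ + D/8)·P ≤ (1−Δ)(D P/8 − A₀ D/2)
  have hU := sectorE_le_uniform (L := L) (Δ := Δ) (M := M) m hm
  rw [hSA, ← hD] at hU
  -- (U') divided by P and multiplied by V(V−1):  (E_Δ + D/8)·V(V−1) ≤ (1−Δ)(D V(V−1)/8 − (D/2)·n(V−n))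
  have hU' : (sectorE L Δ M + (1/8 : ℝ) * D) * ((V : ℝ) * ((V : ℝ) - 1))
      ≤ (1 - Δ) * ((1/8 : ℝ) * D * ((V : ℝ) * ((V : ℝ) - 1)) - D / 2 * ((n : ℝ) * ((V : ℝ) - n))) := by
    have hVV : 0 ≤ (V : ℝ) * ((V : ℝ) - 1) := by nlinarith
    have h1 := mul_le_mul_of_nonneg_right hU hVV
    have h2 : (1 - Δ) * ((1/8 : ℝ) * D * P - (1/4 : ℝ) * (2 * A₀ * D)) * ((V : ℝ) * ((V : ℝ) - 1))
        = ((1 - Δ) * ((1/8 : ℝ) * D * ((V : ℝ) * ((V : ℝ) - 1)) - D / 2 * ((n : ℝ) * ((V : ℝ) - n)))) * P := by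
      have : A₀ * ((V : ℝ) * ((V : ℝ) - 1)) = (n : ℝ) * ((V : ℝ) - n) * P := by linear_combination hAcount
      linear_combination (-((1 - Δ) * D / 2)) * this
    rw [h2, show (sectorE L Δ M + (1/8 : ℝ) * D) * P * ((V : ℝ) * ((V : ℝ) - 1))
        = ((sectorE L Δ M + (1/8 : ℝ) * D) * ((V : ℝ) * ((V : ℝ) - 1))) * P by ring] at h1
    exact le_of_mul_le_mul_right h1 hPpos
  -- (E1)  E_1 ≥ −D/8
  obtain ⟨a₁, ha₁⟩ := exists_perronAmplitude L 1 M (spinZSector_ne_bot_of_perron ha)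
  have hE1 := sectorE_one_ge ha₁
  rw [← hD] at hE1
  -- (D4)  0 ≤ D ≤ 4V
  have hD4 : D ≤ 4 * (V : ℝ) := by
    rw [hD, hVdef]
    calc (∑ x : TorusSite 2 L, ∑ y, if (torusGraph 2 L).Adj x y then (1:ℝ) else 0)
        ≤ ∑ _x : TorusSite 2 L, (4 : ℝ) := Finset.sum_le_sum fun x _ => torus_degree_le_four x
      _ = 4 * (Fintype.card (TorusSite 2 L) : ℝ) := by rw [Finset.sum_const, Finset.card_univ, nsmul_eq_mul]; ring
  have hD0 : 0 ≤ D := by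
    rw [hD]; exact Finset.sum_nonneg fun x _ => Finset.sum_nonneg fun y _ => by positivity
  -- n(n−1) ≥ 0 for a natural number
  have hnn : 0 ≤ (n : ℝ) * ((n : ℝ) - 1) := by
    rcases Nat.eq_zero_or_pos n with h0 | hpos
    · rw [h0]; norm_num
    · have : (1 : ℝ) ≤ n := by exact_mod_cast hpos
      nlinarith
  -- the target, with n in place of V/2 + M and cleared denominators
  rw [← hn]
  have hGL : groundLift L Δ M = sectorE L Δ M - sectorE L 1 M - (1 - Δ) * ((1/8 : ℝ) * D - D / (2 * (V : ℝ)) * (n : ℝ)) := by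
    unfold groundLift liftShift adjCount
    rw [← hD, ← hVdef, ← hn]
  rw [hGL, le_div_iff₀ hV1]
  have hV0 : (V : ℝ) ≠ 0 := hVpos.ne'
  have hlhs : (sectorE L Δ M - sectorE L 1 M - (1 - Δ) * ((1/8 : ℝ) * D - D / (2 * (V : ℝ)) * (n : ℝ))) * ((V : ℝ) - 1) * (V : ℝ)
      = (sectorE L Δ M + (1/8 : ℝ) * D) * ((V : ℝ) * ((V : ℝ) - 1))
        - (sectorE L 1 M + (1/8 : ℝ) * D) * ((V : ℝ) * ((V : ℝ) - 1))
        - (1 - Δ) * ((1/8 : ℝ) * D * ((V : ℝ) * ((V : ℝ) - 1)) - D / 2 * ((n : ℝ) * ((V : ℝ) - 1))) := by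
    field_simp
    ring
  have f2 : 0 ≤ (sectorE L 1 M + (1/8 : ℝ) * D) * ((V : ℝ) * ((V : ℝ) - 1)) := by
    apply mul_nonneg
    · linarith
    · nlinarith
  have f3 : (1 - Δ) * (D / 2) * ((n : ℝ) * ((n : ℝ) - 1)) ≤ (1 - Δ) * (2 * (V : ℝ)) * ((n : ℝ) * ((n : ℝ) - 1)) := by
    apply mul_le_mul_of_nonneg_right _ hnn
    apply mul_le_mul_of_nonneg_left _ (by linarith)
    linarith
  have key : (sectorE L Δ M - sectorE L 1 M - (1 - Δ) * ((1/8 : ℝ) * D - D / (2 * (V : ℝ)) * (n : ℝ))) * ((V : ℝ) - 1) * (V : ℝ)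
      ≤ (1 - Δ) * (2 * (n : ℝ) * ((n : ℝ) - 1)) * (V : ℝ) := by
    rw [hlhs]
    have e1 : (1 - Δ) * ((1/8 : ℝ) * D * ((V : ℝ) * ((V : ℝ) - 1)) - D / 2 * ((n : ℝ) * ((V : ℝ) - n)))
        - (1 - Δ) * ((1/8 : ℝ) * D * ((V : ℝ) * ((V : ℝ) - 1)) - D / 2 * ((n : ℝ) * ((V : ℝ) - 1)))
        = (1 - Δ) * (D / 2) * ((n : ℝ) * ((n : ℝ) - 1)) := by ring
    have e2 : (1 - Δ) * (2 * (V : ℝ)) * ((n : ℝ) * ((n : ℝ) - 1)) = (1 - Δ) * (2 * (n : ℝ) * ((n : ℝ) - 1)) * (V : ℝ) := by ring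
    linarith [hU', f2, f3, e1, e2]
  exact le_of_mul_le_mul_right key hVpos

/-- **THEOREM near-END (uniform-trial version), kernel-checked modulo the named fact CLR:** for every `L ≥ 3`, `Δ ≤ 1` and sector `M`
(`n = L²/2 + M` particles) the Temple-form sector gap of `H(Δ)` is at least `1 − cos(2π/L) − (1 − Δ)·2n(n−1)/(L² − 1)`.
For `n = 2` this is GM₂-near-END with loss `4η/(L²−1)`; for `n = 3` the loss `12η/(L²−1)` is `< ε₁ = 1 − cos(2π/L)` for all `L ≥ 4`
(memo §230: THEOREM near-END₃). [new: theory seat hubbard-h0-rotor-theory-1, cycle 19] -/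
theorem nearEnd_uniform (hCLR : FerroSectorGapCLR) {L : ℕ} [NeZero L] (hL : 3 ≤ L) {Δ : ℝ} (hΔ : Δ ≤ 1) (M : ℝ) :
    SectorGapAtLeast L Δ M
      (1 - Real.cos (2 * Real.pi / (L : ℝ))
        - (1 - Δ) * (2 * ((Fintype.card (TorusSite 2 L) : ℝ) / 2 + M) * (((Fintype.card (TorusSite 2 L) : ℝ) / 2 + M) - 1))
            / ((Fintype.card (TorusSite 2 L) : ℝ) - 1)) := by
  intro a φ ha hφ hunit
  have hL2 : 2 ≤ L := le_trans (by norm_num) hL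
  exact sectorGapAtLeast_of_lift hΔ (hCLR L hL M) (groundLift_le_tangent ha hL2 hΔ) a φ ha hφ hunit

end Summit.HubbardSuperconductivity.HubbardSuperconductivity.Theorems.AnisotropyChord.Transfer
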